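import Summits.Ventures.CertifiedManyBodySolver.Observables.PairBoxWordD4
import Summits.Ventures.CertifiedManyBodySolver.Observables.PairWordD4Orbit
import Summits.Ventures.CertifiedManyBodySolver.Certificates.HubbardSquare_n7o8_stiffness_tp0_chord_r354_r426
import Summits.Ventures.CertifiedManyBodySolver.Certificates.HubbardSquare_n7o8_stiffness_tp0_TLkinetic_rows
import HarnessLib

/-!
# Ventures/CertifiedManyBodySolver — Observables/RungLeaves.lean

HONEST FRAMING: first certified bounds on pairing observables; not a superconductivity verdict; every number certified (two
lineages + referee) or labelled float. hubbard-obs cell (D-0042), ladder rung R2(a) / M3′-obs at `(U, n, t′) = (8, 7/8, 0)`; filed by the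
obs-lit seat on the lead's word (STATUS «LEAVES v0» 2026-08-25T18:53:06Z, director D-0061). Zero compute; no certificate; no `sorry`.

**LEAVES = the closed `Prop`s that STATE this rung's certified TARGETS**, so that the director's rung table can point at ONE Lean name per
target and the registry rows (HOME/CERTIFIED-OBS.md) discharge them by name. Three leaves, each an UNCONDITIONAL sentence about the
thermodynamic-limit state class of the cell (torus limits `ω` of unit `(rectN (7/8) L, S^z = 0)`-sector ground states of `hubbardTorusTT' L 1 0 8`,
`L_j → ∞`; Rows/DopedTLCorr.lean §B) — the leaf `Prop`s carry no energy hypothesis inside; every PROOF of a leaf offered here is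
CONDITIONAL ON THE CLAIM NODES, which enter as explicit hypotheses BY NAME (the certified energy rows #354 cap, #473 floor, #426 …, and the
observable rows), exactly as in every certificate file of the venture (claim nodes `@[conjecture] def … : Prop` certified OUTSIDE Lean by two
code-disjoint readers + referee replay, carried in Lean as hypotheses; obs-ref O-D(d5): registry sentences stay conditional on them).
* `M3ObsStiffnessCeilingAt_tp0 c` / **`M3ObsStiffnessCeiling_tp0`** (`c = 906213886029816052260099/2⁸¹ ≈ 0.3748013`, registry row 6
  `OBS.rhos.tp0.TLchord354x426`): every uniform flux stiffness `ρ_s > 0` (scale `θ₀ > 0`, all even `L ≥ L₀`) of the zero-flux `(N_L, 0)` sectors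
  of `hubbardTorus 2 L 1 8` at density `7/8` is `≤ c`. CLOSED modulo the claim nodes: `M3ObsStiffnessCeiling_tp0_of (h354) (h426)` =
  `m3_tp0_fluxStiffness_le_chordSharp_r354_r426` (p402234). Tonight's `kinlo` edge feeds `M3ObsStiffnessCeilingAt_tp0 (−q/4)` through p2's hook
  `m3_tp0_fluxStiffness_le_of_kineticDensity_ge` (p404025); `…At_tp0_mono` transports any ceiling to a weaker one.
* `M3ObsPairWindowAtRangeR21At_tp0 W` / **`M3ObsPairWindowAtRange_r21_tp0`** (`W = 1`, the cell's KILL threshold K5): there are rationals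
  `lo ≤ hi`, `hi − lo ≤ W`, with `lo ≤ P̄_d(2,1)(ω) ≤ hi` for every `ω` of the class, `P̄_d(2,1)(ω) := |D₄|⁻¹ Σ_γ Re ω.dWavePairCorr 0 (γ·(2,1))`
  (the `D₄`-class mean of the `d`-wave pair correlator AT RANGE — the two `Φ`'s share no site). OPEN at filing time; decided by tonight's EXT5-L⁺ /
  T2 edges: `M3ObsPairWindowAtRangeR21At_tp0_of_orbitRows` turns a certified (lower, upper) pair of `D₄`-ORBIT cells on the two-point pair word
  (the honest cell for symmetry-reduced certificates; dictionary `m3CorrOrbitLowerRow_dWavePair_iff`, p402323) plus the cap premise into the leaf.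
* `M3ObsODLROCeilingAt_tp0 c` / **`M3ObsODLROCeiling_tp0`** (`c = 1/2`): the `d`-wave PAIR ODLRO DENSITY of every `ω` of the class — `braggWeight μ 0`
  for ANY finite measure `μ` representing `r ↦ ω.dWavePairCorr 0 r` (Herglotz; the atom at `Q = 0` = Scalapino's `lim P_d`) — is `≤ c`. OPEN at filing
  time; `M3ObsODLROCeilingAt_tp0_of_orbitRow` turns a certified orbit cell on the NEGATED box pair word `−Σ_{x,y∈B} Φ_x†Φ_y` (tonight's `F2up` edges,
  `B` = 3×3, `|B|² = 81`) into the leaf with `c = F₂^up/81` (hubbard-obs-p1 `m3_dWavePair_braggWeight_le_of_orbitLowerRow_neg`, p402180; no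
  `D₄`-invariance assumed). HONEST: «normalisation-limited» — at `R = 2` the ceiling is `≥ 0.22` even for the exact state, never informative versus
  the printed `m_d² ≲ 1.3·10⁻³` (t′ = 0; obs-lit PRINTED.md §A3); a ceiling says nothing about the presence of pairing.
References: Scalapino–White–Zhang, PRB 47 (1993) 7995, §II [ScalapinoWhiteZhang1993]; D. J. Scalapino, Phys. Rep. 250 (1995) 329, §2 [Scalapino1995];
Hazra–Verma–Randeria, PRX 9 (2019) 031049, eqs. (2)–(4) [HazraVermaRanderia2019].
-/

noncomputable section

namespace Summit.Ventures.CertifiedManyBodySolver.Observables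

open Matrix Literature.MathematicalPhysics.QuantumLattice Literature.Probability.LatticeModels
open Literature.MathematicalPhysics.QuantumLattice.HubbardWave0 ThermodynamicLimit
open Summit.Ventures.CertifiedManyBodySolver.Certificates
open MeasureTheory Complex Filter Topology
open scoped BigOperators ComplexOrder

/-! ## Leaf 1 — stiffness ceiling (t′ = 0) -/

/-- **M3′-obs stiffness ceiling `c` at `(8, 7/8, 0)`**: every uniform flux stiffness `ρ_s > 0` (scale `θ₀ > 0`, all even `L ≥ L₀`) of the
zero-flux `(N_L, 0)` sectors of `hubbardTorus 2 L 1 8` at density `7/8` satisfies `ρ_s ≤ c` (tree units; Hazra–Verma–Randeria `D_s = ρ_s/2`,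
Scalapino–White–Zhang `D/(πe²) = 2ρ_s`). The registry's stiffness rows are instances. [cite: ScalapinoWhiteZhang1993, §II] -/
def M3ObsStiffnessCeilingAt_tp0 (c : ℚ) : Prop :=
  ∀ (ρs θ₀ : ℝ), 0 < ρs → 0 < θ₀ → ∀ L₀ : ℕ,
    (∀ (L : ℕ) [NeZero L], L₀ ≤ L → Even L →
      ∀ θ : ℝ, |θ| ≤ θ₀ → ρs * θ ^ 2 ≤ fluxEnergy L 8 (1 / 8) θ - fluxEnergy L 8 (1 / 8) 0) →
    ρs ≤ ((c : ℚ) : ℝ)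

/-- **LEAF `M3ObsStiffnessCeiling_tp0`** = the ceiling OF RECORD `906213886029816052260099/2⁸¹ ≈ 0.3748013` (registry row 6 `OBS.rhos.tp0.TLchord354x426`,
energy chord #354 ↔ #426). [cite: HazraVermaRanderia2019, eqs. (2)–(4)] -/
@[conjecture] def M3ObsStiffnessCeiling_tp0 : Prop :=
  M3ObsStiffnessCeilingAt_tp0 (906213886029816052260099 / 2 ^ 81)

/-- Monotone transport: a ceiling `c` is a ceiling `c'` for every `c ≤ c'`. -/
theorem M3ObsStiffnessCeilingAt_tp0_mono {c c' : ℚ} (h : M3ObsStiffnessCeilingAt_tp0 c) (hcc : c ≤ c') :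
    M3ObsStiffnessCeilingAt_tp0 c' :=
  fun ρs θ₀ hρs hθ₀ L₀ hst => (h ρs θ₀ hρs hθ₀ L₀ hst).trans (by exact_mod_cast hcc)

/-- The leaf of record CLOSED modulo the claim nodes #354 and #426 (`m3_tp0_fluxStiffness_le_chordSharp_r354_r426`, p402234). -/
theorem M3ObsStiffnessCeiling_tp0_of (h354 : cert_dbt299pair_allk)
    (h426 : cert_r426_bs_GU4n7o8tp0_w3_b4_R2_ob5p2_kry1_su2c16_hop2_hanK6B4D4_box5d2_KN4_uprime) :
    M3ObsStiffnessCeiling_tp0 :=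
  m3_tp0_fluxStiffness_le_chordSharp_r354_r426 h354 h426

/-- KINETIC-ROW FEED (for tonight's `kinlo` edge): a thermodynamic-limit kinetic floor `K ≤ k(ω)` on the class (bond form, the shape produced by
`m3CorrOrbitLowerRow_kinWord_negKinetic_le`-type readings) gives the leaf at `c = −K/4` whenever `−K/4 ≤ c` — p2's hook
`m3_tp0_fluxStiffness_le_of_kineticDensity_ge` (p404025). [cite: ScalapinoWhiteZhang1993, §II] -/
theorem M3ObsStiffnessCeilingAt_tp0_of_kineticDensity_ge (K : ℝ) (c : ℚ) (hKc : -K / 4 ≤ ((c : ℚ) : ℝ))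
    (hrow : ∀ (ω : InfVolFermionState 2) (Ls : ℕ → ℕ) (ψ : ∀ L, Fock (Orb (FermionTorus 2 L))),
      Tendsto Ls atTop atTop →
      (∀ j, IsGroundStateInSector (hubbardTorusTT' (Ls j) 1 0 8) (rectN (7/8) (Ls j)) 0 (ψ (Ls j))) →
      (∀ j, star (ψ (Ls j)) ⬝ᵥ ψ (Ls j) = 1) → ω.IsTorusLimitOf ψ Ls →
      K ≤ ∑ i : Fin 2, -(1 : ℝ) * ∑ σ : Fin 2,
        ((ω.expect {0, 0 + unitVec i}
            ((cAt 0 (Finset.mem_insert_self _ _) σ)ᴴ * cAt (0 + unitVec i) (Finset.mem_insert_of_mem (Finset.mem_singleton_self _)) σ)).re +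
          (ω.expect {0, 0 + unitVec i}
            ((cAt (0 + unitVec i) (Finset.mem_insert_of_mem (Finset.mem_singleton_self _)) σ)ᴴ * cAt 0 (Finset.mem_insert_self _ _) σ)).re)) :
    M3ObsStiffnessCeilingAt_tp0 c :=
  fun ρs θ₀ hρs hθ₀ L₀ hst => (m3_tp0_fluxStiffness_le_of_kineticDensity_ge K hrow ρs θ₀ hρs hθ₀ L₀ hst).trans hKc

/-! ## Leaf 2 — a two-sided window of width ≤ W on the pair correlator AT RANGE, class (2,1) (t′ = 0) -/

/-- The `D₄`-class mean of the `d`-wave pair correlator at displacement `r`: `P̄_d(r)(ω) := |D₄|⁻¹ Σ_γ Re ω.dWavePairCorr 0 (γ·r)`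
(for translation-invariant `ω` the mean over the orbit `D₄·r`; = `Re ω.dWavePairCorr 0 r` for a `D₄`-invariant `ω`). [cite: Scalapino1995, §2 eq. (2.4)] -/
def dWavePairClassMean (ω : InfVolFermionState 2) (r : Site 2) : ℝ :=
  ((Finset.univ : Finset (DihedralGroup 4)).card : ℝ)⁻¹ *
    ∑ γ ∈ (Finset.univ : Finset (DihedralGroup 4)), (ω.dWavePairCorr 0 (d4Vec γ r)).re

/-- **A certified two-sided window of width `≤ W` on `P̄_d(2,1)`** over the cell's thermodynamic-limit class at `(8, 7/8, 0)`:
`∃ lo hi : ℚ, lo ≤ hi ∧ hi − lo ≤ W ∧ ∀ ω of the class, lo ≤ P̄_d(2,1)(ω) ≤ hi`. -/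
def M3ObsPairWindowAtRangeR21At_tp0 (W : ℚ) : Prop :=
  ∃ lo hi : ℚ, lo ≤ hi ∧ hi - lo ≤ W ∧
    ∀ (ω : InfVolFermionState 2) (Ls : ℕ → ℕ) (ψ : ∀ L, Fock (Orb (FermionTorus 2 L))),
      Tendsto Ls atTop atTop →
      (∀ j, IsGroundStateInSector (hubbardTorusTT' (Ls j) 1 0 8) (rectN (7/8) (Ls j)) 0 (ψ (Ls j))) →
      (∀ j, star (ψ (Ls j)) ⬝ᵥ ψ (Ls j) = 1) → ω.IsTorusLimitOf ψ Ls →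
      ((lo : ℚ) : ℝ) ≤ dWavePairClassMean ω ![2, 1] ∧ dWavePairClassMean ω ![2, 1] ≤ ((hi : ℚ) : ℝ)

/-- **LEAF `M3ObsPairWindowAtRange_r21_tp0`** = width `≤ 1` (the cell's pre-registered KILL threshold K5 for the first anchor-level at-range window).
OPEN at filing time (2026-08-25); decided by the rung-0b EXT5-L⁺ / T2 `P_d(2,1)` edges. -/
@[conjecture] def M3ObsPairWindowAtRange_r21_tp0 : Prop :=
  M3ObsPairWindowAtRangeR21At_tp0 1

/-- Monotone in the width. -/
theorem M3ObsPairWindowAtRangeR21At_tp0_mono {W W' : ℚ} (h : M3ObsPairWindowAtRangeR21At_tp0 W) (hW : W ≤ W') :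
    M3ObsPairWindowAtRangeR21At_tp0 W' := by
  obtain ⟨lo, hi, hle, hw, hall⟩ := h
  exact ⟨lo, hi, hle, hw.trans hW, hall⟩

/-- **Certified orbit rows ⇒ the leaf.** A LOWER `D₄`-orbit cell `q_lo ≤ ·` on the two-point pair word at `(0, (2,1))` and a LOWER orbit cell `q_up ≤ ·` on
the NEGATED word (i.e. `· ≤ −q_up`), both at energy cap `u`, plus a proof of the cap cell `M3EnergyUpperRow 0 hi` with `hi ≤ u` (any landed cap node),
give the window leaf at every width `W ≥ −q_up − q_lo` (dictionary `m3CorrOrbitLowerRow_dWavePair_iff`, p402323). The two-row (DIRECT) claim nodes of the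
rung-0b files are fed in after discharging their floor hypothesis. [cite: Scalapino1995, §2 eq. (2.4)] -/
theorem M3ObsPairWindowAtRangeR21At_tp0_of_orbitRows {u hi qlo qup W : ℚ}
    (hlo : M3CorrOrbitLowerRow 0 u qlo Finset.univ
      (pairRegion (insert (0 : Site 2) unitSteps) 0 ∪ pairRegion (insert (0 : Site 2) unitSteps) ![2, 1])
      (fermionEmbed (PolySite.incl Finset.subset_union_left) (localPairAt (insert (0 : Site 2) unitSteps) dWaveFormFactor 0)ᴴ *
        fermionEmbed (PolySite.incl Finset.subset_union_right) (localPairAt (insert (0 : Site 2) unitSteps) dWaveFormFactor ![2, 1])))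
    (hup : M3CorrOrbitLowerRow 0 u qup Finset.univ
      (pairRegion (insert (0 : Site 2) unitSteps) 0 ∪ pairRegion (insert (0 : Site 2) unitSteps) ![2, 1])
      (-(fermionEmbed (PolySite.incl Finset.subset_union_left) (localPairAt (insert (0 : Site 2) unitSteps) dWaveFormFactor 0)ᴴ *
        fermionEmbed (PolySite.incl Finset.subset_union_right) (localPairAt (insert (0 : Site 2) unitSteps) dWaveFormFactor ![2, 1]))))
    (hE : M3EnergyUpperRow 0 hi) (hhi : hi ≤ u) (hq : qlo ≤ -qup) (hW : -qup - qlo ≤ W) :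
    M3ObsPairWindowAtRangeR21At_tp0 W := by
  refine ⟨qlo, -qup, hq, by linarith, fun ω Ls ψ h1 h2 h3 h4 => ?_⟩
  have hu : energyDensityTT' 1 0 8 (7 / 8) ≤ ((u : ℚ) : ℝ) :=
    (show energyDensityTT' 1 0 8 (7 / 8) ≤ ((hi : ℚ) : ℝ) from hE).trans (by exact_mod_cast hhi)
  have hl := (m3CorrOrbitLowerRow_dWavePair_iff 0 u qlo Finset.univ ![2, 1]).1 hlo ω Ls ψ h1 h2 h3 h4 hu
  have hu' := hup ω Ls ψ h1 h2 h3 h4 hu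
  have hneg : ∀ γ : DihedralGroup 4,
      (ω.expect (d4ShiftSet γ 0 (pairRegion (insert (0 : Site 2) unitSteps) 0 ∪ pairRegion (insert (0 : Site 2) unitSteps) ![2, 1]))
        (fermionEmbed (PolySite.d4Emb γ 0 (pairRegion (insert (0 : Site 2) unitSteps) 0 ∪ pairRegion (insert (0 : Site 2) unitSteps) ![2, 1]))
          (-(fermionEmbed (PolySite.incl Finset.subset_union_left) (localPairAt (insert (0 : Site 2) unitSteps) dWaveFormFactor 0)ᴴ *
            fermionEmbed (PolySite.incl Finset.subset_union_right) (localPairAt (insert (0 : Site 2) unitSteps) dWaveFormFactor ![2, 1]))))).re =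
      -(ω.dWavePairCorr 0 (d4Vec γ ![2, 1])).re := fun γ => by
    rw [map_neg, map_neg, Complex.neg_re, expect_d4Emb_dWavePairWord, add_zero, add_zero, (d4Vec_eq_zero_iff γ 0).2 rfl]
  simp only [hneg, Finset.sum_neg_distrib, mul_neg] at hu'
  refine ⟨?_, ?_⟩
  · simpa [dWavePairClassMean] using hl
  · have : dWavePairClassMean ω ![2, 1] ≤ -((qup : ℚ) : ℝ) := by
      unfold dWavePairClassMean; linarith
    simpa using this

/-! ## Leaf 3 — a ceiling on the d-wave pair ODLRO density (t′ = 0) -/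

/-- **A certified ceiling `c` on the `d`-wave PAIR ODLRO DENSITY** over the cell's class at `(8, 7/8, 0)`: for every `ω` of the class and every finite
measure `μ` on the torus representing its `d`-wave pair two-point function `r ↦ ω.dWavePairCorr 0 r` (Herglotz, `exists_representing_pairCorr`), the Bragg weight at
`Q = 0` satisfies `braggWeight μ 0 ≤ c`. [cite: Scalapino1995, §2 eq. (2.4)] -/
def M3ObsODLROCeilingAt_tp0 (c : ℚ) : Prop :=
  ∀ (ω : InfVolFermionState 2) (Ls : ℕ → ℕ) (ψ : ∀ L, Fock (Orb (FermionTorus 2 L))),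
    Tendsto Ls atTop atTop →
    (∀ j, IsGroundStateInSector (hubbardTorusTT' (Ls j) 1 0 8) (rectN (7/8) (Ls j)) 0 (ψ (Ls j))) →
    (∀ j, star (ψ (Ls j)) ⬝ᵥ ψ (Ls j) = 1) → ω.IsTorusLimitOf ψ Ls →
    ∀ (μ : Measure (EuclideanSpace ℝ (Fin 2))) [IsFiniteMeasure μ],
      (∀ r : Site 2, ∫ ξ, exp ((∑ i, (r i : ℝ) * ξ i : ℝ) * I) ∂μ = ω.dWavePairCorr 0 r) →
      braggWeight μ ![(0 : Fin 2 → ℝ)] ≤ ((c : ℚ) : ℝ)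

/-- **LEAF `M3ObsODLROCeiling_tp0`** = ceiling `1/2` (in the `F₂/81` normalisation: `braggWeight ≤ F₂^up/|B|²`). OPEN at filing time (2026-08-25); decided by the
rung-0b `F2up` edges. HONEST: «normalisation-limited»; a ceiling says nothing about the presence of pairing. -/
@[conjecture] def M3ObsODLROCeiling_tp0 : Prop :=
  M3ObsODLROCeilingAt_tp0 (1 / 2)

/-- Monotone transport. -/
theorem M3ObsODLROCeilingAt_tp0_mono {c c' : ℚ} (h : M3ObsODLROCeilingAt_tp0 c) (hcc : c ≤ c') : M3ObsODLROCeilingAt_tp0 c' :=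
  fun ω Ls ψ h1 h2 h3 h4 μ _ hμ => (h ω Ls ψ h1 h2 h3 h4 μ hμ).trans (by exact_mod_cast hcc)

/-- **Certified orbit row on the negated box pair word ⇒ the leaf.** A LOWER `D₄`-orbit cell `q ≤ ·` on `−Σ_{x,y∈B} Φ_x†Φ_y` (the `F₂`-type UPPER edge, any finite
nonempty box `B`, energy cap `u`) plus the cap cell `M3EnergyUpperRow 0 hi`, `hi ≤ u`, gives the ODLRO leaf at every `c ≥ −q/|B|²` — hubbard-obs-p1's
`m3_dWavePair_braggWeight_le_of_orbitLowerRow_neg` (p402180; no `D₄`-invariance of `ω` or `B` assumed). [cite: Scalapino1995, §2 eq. (2.4)] -/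
theorem M3ObsODLROCeilingAt_tp0_of_orbitRow {u hi q c : ℚ} {B : Finset (Site 2)} (hB : B.Nonempty)
    (h : M3CorrOrbitLowerRow 0 u q Finset.univ (B.biUnion (pairRegion (insert (0 : Site 2) unitSteps)))
      (-pairBoxWord (insert (0 : Site 2) unitSteps) dWaveFormFactor B))
    (hE : M3EnergyUpperRow 0 hi) (hhi : hi ≤ u) (hc : -((q : ℚ) : ℝ) / ((B.card : ℝ)) ^ 2 ≤ ((c : ℚ) : ℝ)) :
    M3ObsODLROCeilingAt_tp0 c :=
  fun ω Ls ψ h1 h2 h3 h4 μ _ hμ =>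
    (m3_dWavePair_braggWeight_le_of_orbitLowerRow_neg (S := Finset.univ) Finset.univ_nonempty hB h hE hhi ω Ls ψ h1 h2 h3 h4 μ hμ).trans hc

end Summit.Ventures.CertifiedManyBodySolver.Observables

end
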